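import Summits.QuantumFields.QCD.Theses.HeatSlicedQuarks
import Literature.MathematicalPhysics.QuantumLattice.DuhamelTwoPoint
import Summits.QuantumFields.QCD.Theorems.HeatSlicedQuarksUniformLocalSpectralBound

/-!
# Stub `stub_abstractCLR` of line `Sketch` (idea `drop-the-wilson-square`) — part 1: eigenbasis toolkit and
# the weighted local Weyl law
(crux `Summit.QuantumFields.QCD.Theses.HeatSlicedQuarks.ActionBoundsLowModes`, item stmt-QuantumFields-8872,
route route-QuantumFields-HeatSlicedQuarks; lead prover-line-stmt-QuantumFields-8872-0)

For a positive definite complex matrix `T = V diag(λ) V⋆` (`V = eigenvectorUnitary`, `λ = eigenvalues > 0`):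
* eigenbasis bookkeeping (`V` is an isometry, `Re⟨u,Tu⟩ = Σ_k λ_k |c_k|²` with `c = V⋆u`, resolvent powers
  `((T+E)⁻¹)^N = V diag((λ+E)⁻ᴺ) V⋆` and their diagonal entries);
* **the weighted local Weyl law** (`weightedLocalWeyl`): if `Re((T+E)⁻¹)⁴(i,i) ≤ K/E²` for all `E > 0`
  then for every `Λ > 0`, `Σ_{k : λ_k < Λ} λ_k⁻¹ |V_{ik}|² ≤ 64 K Λ` — from the projector bound
  `Σ_{λ_k ≤ E} |V_{ik}|² ≤ 16 E⁴ Σ_k (λ_k+E)⁻⁴|V_{ik}|² ≤ 16 K E²` and the pointwise dyadic layer cake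
  `λ⁻¹ 1(λ<Λ) ≤ Σ_{r=0}^{N} (2^{r+1}/Λ) 1(λ ≤ Λ/2^r)`.
Pure theorem file (no definitions); Mathlib + the tree's `DuhamelTwoPoint` spectral idiom only.
-/

namespace Summit.QuantumFields.QCD.Cruxes.ActionBoundsLowModes.DropTheWilsonSquare

open Matrix Summit.QuantumFields.QCD.Theorems.HeatSlicedQuarks
open scoped ComplexOrder

section Eigenbasis

variable {n : Type*} [Fintype n] [DecidableEq n]

variable {T : Matrix n n ℂ}

/-- `V⋆ V = 1` for the eigenvector matrix. -/
theorem clr_star_V_mul_V (hH : T.IsHermitian) :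
    star (hH.eigenvectorUnitary : Matrix n n ℂ) * (hH.eigenvectorUnitary : Matrix n n ℂ) = 1 :=
  Unitary.star_mul_self_of_mem hH.eigenvectorUnitary.prop

/-- `V V⋆ = 1` for the eigenvector matrix. -/
theorem clr_V_mul_star_V (hH : T.IsHermitian) :
    (hH.eigenvectorUnitary : Matrix n n ℂ) * star (hH.eigenvectorUnitary : Matrix n n ℂ) = 1 :=
  Unitary.mul_star_self_of_mem hH.eigenvectorUnitary.prop

/-- `V (V⋆ u) = u`. -/
theorem clr_V_mulVec_star_V_mulVec (hH : T.IsHermitian) (u : n → ℂ) :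
    (hH.eigenvectorUnitary : Matrix n n ℂ) *ᵥ (star (hH.eigenvectorUnitary : Matrix n n ℂ) *ᵥ u) = u := by
  rw [mulVec_mulVec, clr_V_mul_star_V, one_mulVec]

/-- `V` is an isometry: `Σ_i ‖(V w) i‖² = Σ_k ‖w k‖²`. -/
theorem clr_sum_norm_sq_V_mulVec (hH : T.IsHermitian) (w : n → ℂ) :
    ∑ i, ‖((hH.eigenvectorUnitary : Matrix n n ℂ) *ᵥ w) i‖ ^ 2 = ∑ k, ‖w k‖ ^ 2 := by
  refine sum_norm_sq_mulVec_of_isometry _ ?_ w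
  rw [← star_eq_conjTranspose]
  exact clr_star_V_mul_V hH

/-- `V⋆` is an isometry: `Σ_k ‖(V⋆ u) k‖² = Σ_i ‖u i‖²`. -/
theorem clr_sum_norm_sq_star_V_mulVec (hH : T.IsHermitian) (u : n → ℂ) :
    ∑ k, ‖(star (hH.eigenvectorUnitary : Matrix n n ℂ) *ᵥ u) k‖ ^ 2 = ∑ i, ‖u i‖ ^ 2 := by
  refine sum_norm_sq_mulVec_of_isometry _ ?_ u
  rw [star_eq_conjTranspose, conjTranspose_conjTranspose, ← star_eq_conjTranspose]
  exact clr_V_mul_star_V hH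

/-- `⟨u, V y⟩ = ⟨V⋆u, y⟩`. -/
theorem clr_star_dotProduct_V_mulVec (hH : T.IsHermitian) (u y : n → ℂ) :
    star u ⬝ᵥ ((hH.eigenvectorUnitary : Matrix n n ℂ) *ᵥ y) =
      star (star (hH.eigenvectorUnitary : Matrix n n ℂ) *ᵥ u) ⬝ᵥ y := by
  rw [dotProduct_mulVec, star_mulVec, star_eq_conjTranspose, conjTranspose_conjTranspose]

/-- **Quadratic form in the eigenbasis**: `Re⟨u, T u⟩ = Σ_k λ_k ‖(V⋆u)_k‖²`. -/
theorem clr_re_quadForm_eq (hH : T.IsHermitian) (u : n → ℂ) :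
    (star u ⬝ᵥ (T *ᵥ u)).re =
      ∑ k, hH.eigenvalues k * ‖(star (hH.eigenvectorUnitary : Matrix n n ℂ) *ᵥ u) k‖ ^ 2 := by
  set V : Matrix n n ℂ := (hH.eigenvectorUnitary : Matrix n n ℂ) with hV
  set c := star V *ᵥ u with hc
  have hT : T *ᵥ u = V *ᵥ (diagonal (fun k => (hH.eigenvalues k : ℂ)) *ᵥ c) := by
    conv_lhs => rw [hH.eq_conj_diagonal]
    rw [← hV, hc, mulVec_mulVec, mulVec_mulVec, Matrix.mul_assoc]
  rw [hT, hV, clr_star_dotProduct_V_mulVec hH, ← hV, ← hc, dotProduct, Complex.re_sum]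
  refine Finset.sum_congr rfl fun k _ => ?_
  rw [mulVec_diagonal, Pi.star_apply, mul_left_comm, Complex.star_def, ← Complex.normSq_eq_conj_mul_self,
    Complex.normSq_eq_norm_sq, ← Complex.ofReal_mul, Complex.ofReal_re]

/-- `Re⟨u, T u⟩ = Σ_i ‖(V diag(√λ) V⋆ u)_i‖²` is not needed; instead: the quadratic form is nonnegative
when all eigenvalues are nonnegative. -/
theorem clr_re_quadForm_nonneg (hH : T.IsHermitian) (hpos : ∀ k, 0 ≤ hH.eigenvalues k) (u : n → ℂ) :
    0 ≤ (star u ⬝ᵥ (T *ᵥ u)).re := by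
  rw [clr_re_quadForm_eq hH]
  exact Finset.sum_nonneg fun k _ => mul_nonneg (hpos k) (by positivity)

/-- **Resolvent in the eigenbasis**: if `λ_k + E ≠ 0` for all `k` then
`(T + E)⁻¹ = V diag((λ+E)⁻¹) V⋆`. -/
theorem clr_resolvent_eq (hH : T.IsHermitian) (E : ℝ) (hE : ∀ k, hH.eigenvalues k + E ≠ 0) :
    (T + (E : ℂ) • (1 : Matrix n n ℂ))⁻¹ =
      (hH.eigenvectorUnitary : Matrix n n ℂ) * diagonal (fun k => (((hH.eigenvalues k + E)⁻¹ : ℝ) : ℂ)) *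
        star (hH.eigenvectorUnitary : Matrix n n ℂ) := by
  set V : Matrix n n ℂ := (hH.eigenvectorUnitary : Matrix n n ℂ) with hV
  have hVV : star V * V = 1 := clr_star_V_mul_V hH
  have hVV' : V * star V = 1 := clr_V_mul_star_V hH
  have hTE : T + (E : ℂ) • (1 : Matrix n n ℂ) =
      V * diagonal (fun k => ((hH.eigenvalues k + E : ℝ) : ℂ)) * star V := by
    have h1 : (E : ℂ) • (1 : Matrix n n ℂ) = V * diagonal (fun _ => (E : ℂ)) * star V := by
      rw [← smul_one_eq_diagonal, Matrix.mul_smul, Matrix.mul_one, Matrix.smul_mul, hVV']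
    conv_lhs => rw [hH.eq_conj_diagonal, ← hV, h1]
    rw [← Matrix.add_mul, ← Matrix.mul_add, diagonal_add]
    congr 3
    funext k
    push_cast
    rfl
  refine Matrix.inv_eq_right_inv ?_
  have hd : (fun k => ((hH.eigenvalues k + E : ℝ) : ℂ) * (((hH.eigenvalues k + E)⁻¹ : ℝ) : ℂ)) = fun _ => 1 := by
    funext k
    rw [← Complex.ofReal_mul, mul_inv_cancel₀ (hE k), Complex.ofReal_one]
  rw [hTE]
  simp only [Matrix.mul_assoc]
  rw [← Matrix.mul_assoc (star V) V, hVV, Matrix.one_mul, ← Matrix.mul_assoc (diagonal _) (diagonal _),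
    diagonal_mul_diagonal, hd, diagonal_one, Matrix.one_mul, hVV']

/-- Powers of `V diag(w) V⋆`: `(V diag(w) V⋆)^N = V diag(w^N) V⋆`. -/
theorem clr_conj_diagonal_pow (hH : T.IsHermitian) (w : n → ℝ) (N : ℕ) :
    ((hH.eigenvectorUnitary : Matrix n n ℂ) * diagonal (fun k => (w k : ℂ)) *
        star (hH.eigenvectorUnitary : Matrix n n ℂ)) ^ N =
      (hH.eigenvectorUnitary : Matrix n n ℂ) * diagonal (fun k => ((w k ^ N : ℝ) : ℂ)) *
        star (hH.eigenvectorUnitary : Matrix n n ℂ) := by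
  set V : Matrix n n ℂ := (hH.eigenvectorUnitary : Matrix n n ℂ) with hV
  have hVV : star V * V = 1 := clr_star_V_mul_V hH
  have hVV' : V * star V = 1 := clr_V_mul_star_V hH
  induction N with
  | zero =>
      simp only [pow_zero, Complex.ofReal_one, diagonal_one, Matrix.mul_one, hVV']
  | succ N ih =>
      rw [pow_succ, ih]
      have hd : diagonal (fun k => ((w k ^ N : ℝ) : ℂ)) * (star V * (V * diagonal (fun k => (w k : ℂ)))) =
          diagonal (fun k => ((w k ^ (N + 1) : ℝ) : ℂ)) := by
        rw [← Matrix.mul_assoc (star V) V, hVV, Matrix.one_mul, diagonal_mul_diagonal]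
        congr 1
        funext k
        push_cast
        ring
      calc V * diagonal (fun k => ((w k ^ N : ℝ) : ℂ)) * star V * (V * diagonal (fun k => (w k : ℂ)) * star V)
          = V * (diagonal (fun k => ((w k ^ N : ℝ) : ℂ)) * (star V * (V * diagonal (fun k => (w k : ℂ))))) *
              star V := by
            simp only [Matrix.mul_assoc]
        _ = V * diagonal (fun k => ((w k ^ (N + 1) : ℝ) : ℂ)) * star V := by rw [hd]

/-- **Diagonal entries of resolvent powers**: for `E > 0` and a positive semidefinite spectrum,
`Re (((T+E)⁻¹)^N)(i,i) = Σ_k ((λ_k+E)⁻¹)^N ‖V_{ik}‖²`. -/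
theorem clr_re_resolvent_pow_apply (hH : T.IsHermitian) (hpos : ∀ k, 0 ≤ hH.eigenvalues k) {E : ℝ} (hE : 0 < E)
    (N : ℕ) (i : n) :
    ((((T + (E : ℂ) • (1 : Matrix n n ℂ))⁻¹) ^ N) i i).re =
      ∑ k, ((hH.eigenvalues k + E)⁻¹) ^ N * ‖(hH.eigenvectorUnitary : Matrix n n ℂ) i k‖ ^ 2 := by
  have hne : ∀ k, hH.eigenvalues k + E ≠ 0 := fun k => by linarith [hpos k]
  rw [clr_resolvent_eq hH E hne, clr_conj_diagonal_pow hH, conj_diagonal_apply_self, Complex.ofReal_re]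
  exact Finset.sum_congr rfl fun k _ => by ring

end Eigenbasis

/-! ## The weighted local Weyl law -/

section LocalWeyl

variable {n : Type*} [Fintype n] [DecidableEq n] {T : Matrix n n ℂ}

/-- **Projector bound from the resolvent fourth power**: if `Re((T+E)⁻¹)⁴(i,i) ≤ K/E²` for all `E > 0`
then `Σ_{k : λ_k ≤ E} ‖V_{ik}‖² ≤ 16 K E²` (`1(λ ≤ E) ≤ 16 E⁴ (λ+E)⁻⁴` for `λ ≥ 0`). -/
theorem clr_projector_le (hT : T.PosDef) {K : ℝ}
    (hLW : ∀ E : ℝ, 0 < E → ∀ i : n, ((((T + (E : ℂ) • (1 : Matrix n n ℂ))⁻¹) ^ 4) i i).re ≤ K / E ^ 2)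
    {E : ℝ} (hE : 0 < E) (i : n) :
    ∑ k, (if hT.1.eigenvalues k ≤ E then ‖(hT.1.eigenvectorUnitary : Matrix n n ℂ) i k‖ ^ 2 else 0) ≤
      16 * K * E ^ 2 := by
  have hpos : ∀ k, 0 ≤ hT.1.eigenvalues k := fun k => (hT.eigenvalues_pos k).le
  have h := hLW E hE i
  rw [clr_re_resolvent_pow_apply hT.1 hpos hE 4 i] at h
  set V : Matrix n n ℂ := (hT.1.eigenvectorUnitary : Matrix n n ℂ)
  set lam := hT.1.eigenvalues
  -- termwise: `1(λ ≤ E) ≤ 16 E⁴ (λ+E)⁻⁴`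
  have hterm : ∀ k, (if lam k ≤ E then ‖V i k‖ ^ 2 else 0) ≤
      16 * E ^ 4 * (((lam k + E)⁻¹) ^ 4 * ‖V i k‖ ^ 2) := fun k => by
    have hlamE : 0 < lam k + E := by linarith [hpos k]
    split_ifs with hk
    · have h1 : (lam k + E) ^ 4 ≤ 16 * E ^ 4 := by
        have : lam k + E ≤ 2 * E := by linarith
        calc (lam k + E) ^ 4 ≤ (2 * E) ^ 4 := pow_le_pow_left₀ hlamE.le this 4
          _ = 16 * E ^ 4 := by ring
      have h2 : 1 ≤ 16 * E ^ 4 * ((lam k + E)⁻¹) ^ 4 := by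
        rw [inv_pow, ← div_eq_mul_inv, le_div_iff₀ (by positivity)]
        linarith
      calc ‖V i k‖ ^ 2 = 1 * ‖V i k‖ ^ 2 := (one_mul _).symm
        _ ≤ (16 * E ^ 4 * ((lam k + E)⁻¹) ^ 4) * ‖V i k‖ ^ 2 :=
            mul_le_mul_of_nonneg_right h2 (by positivity)
        _ = 16 * E ^ 4 * (((lam k + E)⁻¹) ^ 4 * ‖V i k‖ ^ 2) := by ring
    · positivity
  calc ∑ k, (if lam k ≤ E then ‖V i k‖ ^ 2 else 0)
      ≤ ∑ k, 16 * E ^ 4 * (((lam k + E)⁻¹) ^ 4 * ‖V i k‖ ^ 2) := Finset.sum_le_sum fun k _ => hterm k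
    _ = 16 * E ^ 4 * ∑ k, ((lam k + E)⁻¹) ^ 4 * ‖V i k‖ ^ 2 := by rw [Finset.mul_sum]
    _ ≤ 16 * E ^ 4 * (K / E ^ 2) := by gcongr
    _ = 16 * K * E ^ 2 := by field_simp

/-- Pointwise dyadic layer cake: for `0 < λ < Λ` there is `r ∈ {0,…,N}` (any `N` with
`Λ < 2^{N+1} λ`) such that `λ ≤ Λ/2^r` and `λ⁻¹ < 2^{r+1}/Λ`; consequently
`λ⁻¹ ≤ Σ_{r=0}^{N} (2^{r+1}/Λ) · 1(λ ≤ Λ/2^r)`. -/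
theorem clr_layer_cake {lam Λ : ℝ} (hlam : 0 < lam) (hlamΛ : lam < Λ) {N : ℕ}
    (hN : Λ < 2 ^ (N + 1) * lam) :
    lam⁻¹ ≤ ∑ r ∈ Finset.range (N + 1), (if lam ≤ Λ / 2 ^ r then 2 ^ (r + 1) / Λ else 0) := by
  have hΛ : 0 < Λ := hlam.trans hlamΛ
  -- the set of admissible `r`: `lam ≤ Λ / 2^r`; it contains 0 and is bounded by N
  classical
  let S : Finset ℕ := (Finset.range (N + 1)).filter fun r => lam ≤ Λ / 2 ^ r
  have h0 : 0 ∈ S := by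
    simp only [S, Finset.mem_filter, Finset.mem_range]
    exact ⟨Nat.succ_pos N, by simpa using hlamΛ.le⟩
  have hSne : S.Nonempty := ⟨0, h0⟩
  -- take the largest admissible `r₀`
  set r₀ := S.max' hSne with hr₀
  have hr₀S : r₀ ∈ S := Finset.max'_mem S hSne
  have hr₀' := (Finset.mem_filter.mp hr₀S)
  have hr₀N : r₀ < N + 1 := Finset.mem_range.mp hr₀'.1
  have hr₀lam : lam ≤ Λ / 2 ^ r₀ := hr₀'.2
  -- `r₀ + 1` is not admissible
  have hnext : Λ / 2 ^ (r₀ + 1) < lam := by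
    by_contra hcon
    push Not at hcon
    by_cases hr1 : r₀ + 1 < N + 1
    · have hmem : r₀ + 1 ∈ S := by
        simp only [S, Finset.mem_filter, Finset.mem_range]
        exact ⟨hr1, hcon⟩
      have := Finset.le_max' S (r₀ + 1) hmem
      rw [← hr₀] at this
      omega
    · -- `r₀ = N`: contradiction with `hN`
      have hrN : r₀ = N := by omega
      rw [hrN, le_div_iff₀ (by positivity)] at hcon
      linarith [hcon, hN, mul_comm ((2 : ℝ) ^ (N + 1)) lam]
  -- the single term `r = r₀` already dominates `lam⁻¹`
  have hsingle : lam⁻¹ ≤ (if lam ≤ Λ / 2 ^ r₀ then 2 ^ (r₀ + 1) / Λ else 0) := by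
    rw [if_pos hr₀lam]
    rw [div_lt_iff₀ (by positivity)] at hnext
    rw [inv_eq_one_div, div_le_div_iff₀ hlam hΛ, one_mul]
    linarith
  refine hsingle.trans ?_
  refine Finset.single_le_sum (f := fun r => if lam ≤ Λ / 2 ^ r then (2 : ℝ) ^ (r + 1) / Λ else 0)
    (fun r _ => ?_) (Finset.mem_range.mpr hr₀N)
  split_ifs <;> positivity

/-- **Weighted local Weyl law.**  If `T ≻ 0` and `Re((T+E)⁻¹)⁴(i,i) ≤ K/E²` for all `E > 0`, then for
every `Λ > 0` and every `i`: `Σ_{k : λ_k < Λ} λ_k⁻¹ ‖V_{ik}‖² ≤ 64 K Λ`. -/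
theorem weightedLocalWeyl (hT : T.PosDef) {K : ℝ}
    (hLW : ∀ E : ℝ, 0 < E → ∀ i : n, ((((T + (E : ℂ) • (1 : Matrix n n ℂ))⁻¹) ^ 4) i i).re ≤ K / E ^ 2)
    {Λ : ℝ} (hΛ : 0 < Λ) (i : n) :
    ∑ k, (if hT.1.eigenvalues k < Λ then
        (hT.1.eigenvalues k)⁻¹ * ‖(hT.1.eigenvectorUnitary : Matrix n n ℂ) i k‖ ^ 2 else 0) ≤
      64 * K * Λ := by
  classical
  set V : Matrix n n ℂ := (hT.1.eigenvectorUnitary : Matrix n n ℂ) with hV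
  set lam := hT.1.eigenvalues with hlam
  have hpos : ∀ k, 0 < lam k := fun k => hT.eigenvalues_pos k
  -- `K ≥ 0` (test the hypothesis at any `E`, the diagonal entry is ≥ 0) — only needed if `n` is nonempty
  -- a uniform dyadic depth `N`: `Λ < 2^{N+1} λ_k` for all `k`
  obtain ⟨N, hN⟩ : ∃ N : ℕ, ∀ k, Λ < 2 ^ (N + 1) * lam k := by
    by_cases hne : Nonempty n
    · obtain ⟨k₀, -, hk₀⟩ := Finset.exists_min_image Finset.univ lam (Finset.univ_nonempty_iff.mpr hne)
      obtain ⟨N, hN⟩ := pow_unbounded_of_one_lt (Λ / lam k₀) (by norm_num : (1 : ℝ) < 2)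
      refine ⟨N, fun k => ?_⟩
      have h1 : Λ < 2 ^ N * lam k₀ := by
        rwa [div_lt_iff₀ (hpos k₀)] at hN
      have h2 : lam k₀ ≤ lam k := hk₀ k (Finset.mem_univ k)
      calc Λ < 2 ^ N * lam k₀ := h1
        _ ≤ 2 ^ (N + 1) * lam k := by
            rw [pow_succ]
            nlinarith [hpos k₀, pow_pos (two_pos : (0 : ℝ) < 2) N]
    · exact ⟨0, fun k => (hne ⟨k⟩).elim⟩
  -- pointwise layer cake, multiplied by `‖V i k‖²`
  have hpt : ∀ k, (if lam k < Λ then (lam k)⁻¹ * ‖V i k‖ ^ 2 else 0) ≤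
      ∑ r ∈ Finset.range (N + 1),
        (2 : ℝ) ^ (r + 1) / Λ * (if lam k ≤ Λ / 2 ^ r then ‖V i k‖ ^ 2 else 0) := by
    intro k
    split_ifs with hk
    · have h := clr_layer_cake (hpos k) hk (hN k)
      calc (lam k)⁻¹ * ‖V i k‖ ^ 2
          ≤ (∑ r ∈ Finset.range (N + 1), (if lam k ≤ Λ / 2 ^ r then (2 : ℝ) ^ (r + 1) / Λ else 0)) *
              ‖V i k‖ ^ 2 := mul_le_mul_of_nonneg_right h (by positivity)
        _ = ∑ r ∈ Finset.range (N + 1),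
              (2 : ℝ) ^ (r + 1) / Λ * (if lam k ≤ Λ / 2 ^ r then ‖V i k‖ ^ 2 else 0) := by
            rw [Finset.sum_mul]
            refine Finset.sum_congr rfl fun r _ => ?_
            split_ifs <;> simp
    · exact Finset.sum_nonneg fun r _ => by split_ifs <;> positivity
  -- sum over `k`, swap, and use the projector bound at `E = Λ/2^r`
  calc ∑ k, (if lam k < Λ then (lam k)⁻¹ * ‖V i k‖ ^ 2 else 0)
      ≤ ∑ k, ∑ r ∈ Finset.range (N + 1),
          (2 : ℝ) ^ (r + 1) / Λ * (if lam k ≤ Λ / 2 ^ r then ‖V i k‖ ^ 2 else 0) :=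
        Finset.sum_le_sum fun k _ => hpt k
    _ = ∑ r ∈ Finset.range (N + 1), (2 : ℝ) ^ (r + 1) / Λ *
          ∑ k, (if lam k ≤ Λ / 2 ^ r then ‖V i k‖ ^ 2 else 0) := by
        rw [Finset.sum_comm]
        refine Finset.sum_congr rfl fun r _ => ?_
        rw [Finset.mul_sum]
    _ ≤ ∑ r ∈ Finset.range (N + 1), (2 : ℝ) ^ (r + 1) / Λ * (16 * K * (Λ / 2 ^ r) ^ 2) := by
        refine Finset.sum_le_sum fun r _ => ?_
        exact mul_le_mul_of_nonneg_left (clr_projector_le hT hLW (by positivity) i) (by positivity)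
    _ = 32 * K * Λ * ∑ r ∈ Finset.range (N + 1), (1 / 2 : ℝ) ^ r := by
        rw [Finset.mul_sum]
        refine Finset.sum_congr rfl fun r _ => ?_
        have h2 : (2 : ℝ) ^ r ≠ 0 := by positivity
        rw [_root_.one_div_pow, pow_succ]
        field_simp
        ring
    _ ≤ 32 * K * Λ * 2 := by
        have hK : 0 ≤ K := by
          -- from the projector bound with the (nonneg) left-hand side at `E = Λ`
          have h := clr_projector_le hT hLW hΛ i
          have h0 : 0 ≤ ∑ k, (if hT.1.eigenvalues k ≤ Λ then
              ‖(hT.1.eigenvectorUnitary : Matrix n n ℂ) i k‖ ^ 2 else 0) :=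
            Finset.sum_nonneg fun k _ => by split_ifs <;> positivity
          have h1 : 0 * Λ ^ 2 ≤ 16 * K * Λ ^ 2 := by rw [zero_mul]; exact h0.trans h
          have h3 : (0 : ℝ) ≤ 16 * K := le_of_mul_le_mul_right h1 (by positivity)
          linarith
        refine mul_le_mul_of_nonneg_left ?_ (by positivity)
        have hgeom := geom_sum_Ico_le_of_lt_one (by norm_num : (0 : ℝ) ≤ 1 / 2)
          (by norm_num : (1 / 2 : ℝ) < 1) (m := 0) (n := N + 1)
        rw [Finset.range_eq_Ico]
        refine hgeom.trans ?_
        norm_num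
    _ = 64 * K * Λ := by ring

end LocalWeyl

/-! ## Registered sub-goal -/

/-- **Registered sub-goal `stub_weightedLocalWeyl`** (lead's helper for `stub_abstractCLR`): the weighted
local Weyl law in closed form — for a positive definite `T` whose resolvent fourth power obeys
`Re((T+E)⁻¹)⁴(i,i) ≤ K/E²` for all `E > 0`, and every `Λ > 0`, `Σ_{k : λ_k < Λ} λ_k⁻¹ ‖V_{ik}‖² ≤ 64 K Λ`
(`V`, `λ` = Mathlib's `eigenvectorUnitary`, `eigenvalues`). -/
theorem stub_weightedLocalWeyl :
    ∀ {n : Type} [Fintype n] [DecidableEq n] (T : Matrix n n ℂ) (hT : T.PosDef) (K : ℝ),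
      (∀ E : ℝ, 0 < E → ∀ i : n, ((((T + (E : ℂ) • (1 : Matrix n n ℂ))⁻¹) ^ 4) i i).re ≤ K / E ^ 2) →
      ∀ (Λ : ℝ), 0 < Λ → ∀ (i : n),
        ∑ k, (if hT.1.eigenvalues k < Λ then
            (hT.1.eigenvalues k)⁻¹ * ‖(hT.1.eigenvectorUnitary : Matrix n n ℂ) i k‖ ^ 2 else 0) ≤
          64 * K * Λ :=
  fun _T hT _K hLW _Λ hΛ i => weightedLocalWeyl hT hLW hΛ i

end Summit.QuantumFields.QCD.Cruxes.ActionBoundsLowModes.DropTheWilsonSquare
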